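/-
Soloist artefact (solo-KontsevichZagierPeriods-informed, session s25): the EXTENSION MODEL `𝒟_d`,
part 4 — Proposition VI-ter.  References: A. Huber, G. Wüstholz, *Transcendence and linear
relations of 1-periods*, Cambridge Tracts in Math. 227 (2022), Def. 7.6, Rem. 7.7, Def. 7.11,
Prop. 7.17, Cor. 7.19, App. A.3; A. Huber, S. Müller-Stach, *Periods and Nori motives*,
Ergebnisse 65 (2017), §9 (the localisation `MM_Nori = MM_Nori^eff[𝕃⁻¹]`), §13.1.
-/
import Summits.KontsevichZagierPeriods.KontsevichZagierPeriods.Theorems.SoloInformedExtensionRing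
import Summits.KontsevichZagierPeriods.KontsevichZagierPeriods.Theorems.SoloInformedEffectiveModel
import Summits.KontsevichZagierPeriods.KontsevichZagierPeriods.Theorems.SoloInformedDiagonalCancellation

/-!
# Proposition VI-ter: an extension class that dies under twisting

Part 4 of the extension model `𝒟_d` (`d ≠ 0`; parts 1–3: `SoloInformedExtensionModel`,
`…Periods`, `…Ring`).  `𝒟_d` is a NON-SEMISIMPLE "effective" tensor category with fibre functor
and comparison `diag(c^{deg})`, containing the Kummer object `K` (`0 → 𝟙_0 → K → 𝟙_d → 0`,
non-split); its semisimplification is the dense model `𝒞_ℕ` and its localisation at `𝕃 = 𝟙_1`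
is the group-graded model `𝒞_ℤ` of `SoloInformedEffectiveModel`.  Proved here:

1. `ssMap_eq_zero_iff`, `per_pow_mul_eq_zero_iff`, `loc_eq_zero_iff`: the kernel of
   `P̃(F) : P̃(𝒟_d) → P̃(𝒞_ℤ)`, `F = (ℕ ⊂ ℤ)_* ∘ ss` the localisation functor on formal periods,
   is `ℚ · η = Ann(per) =` the `per^∞`-torsion, and `η² = 0`: EFF-INJ FAILS for `𝒟_d`
   (`loc_not_injective`) through a NILPOTENT phantom — although the semisimplification `𝒞_ℕ`
   satisfies EFF-INJ (`loc_dense_injective`), `P̃(ss)` does not see `η`, and no homomorphism to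
   a reduced ring (no field-valued point of `Spec P̃(𝒟_d)`) sees `η` (`ringHom_eta`, part 3).
2. `evE_clsE`, `evE_not_injective`: the evaluation map of `𝒟_d` [HW22, Def. 7.11] for ANY
   comparison constant `c` factors through `P̃(F)` and kills `η`: the formal period conjecture
   `PC(𝒟_d, c)` fails for every `c`, while `PC(𝒞_ℤ, 2πi)` holds (`pc_localised_twoPiI`).
2bis. `phantom_visible_eta_invisible`: model VI's phantom `p_𝟙 − p_U` is detected by a `ℚ`-point
   `psiPoint` of `Spec P̃(𝒞_E)`; `η` is killed by every homomorphism to a reduced ring.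
2ter. `failure_modes`: `P̃(𝒞_E)` is reduced and not a domain (model VI: a second component of the
   spectrum); `P̃(𝒟_d)` is not reduced with nilradical `= ker P̃(F) = ℚ·η` (model VI-ter: a nilpotent).
3. The mechanism (`twistE_not_full`, `kummer_twist_eq`, `kummer_not_split`): `− ⊗ 𝕃` is faithful
   and NOT FULL on `𝒟_d` (`End K = ℚ`, but `K ⊗ 𝕃` acquires the idempotent `kummerTwistProj`),
   `K ⊗ 𝕃 = K^{ss} ⊗ 𝕃` literally, and `K ≇ K^{ss}`: cancellation of `𝕃` fails for two objects
   with the same class in `K₀` — an EXTENSION dies under the twist.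
4. `soloInformed_propositionVIter`: summary statement.

Relevance (prose, not formalised).  Whether `MM^eff_Nori → MM_Nori` is full is open
[HW22, App. A.3, p. 198; Rem. A.10; Thm. 13.5 settles the subcategory `d₁MM^eff` over `ℚ̄`].  In
model VI (`SoloInformedEffectiveModel`) fullness and EFF-INJ fail through two non-isomorphic
SIMPLE objects that become isomorphic after twisting; that phantom lives in a semisimple
category and is detected by a `ℚ`-point of the formal period ring — it concerns pure objects
only (for Grothendieck motives, whose morphisms are algebraic correspondences, `𝕃` cancels by
the projective bundle formula).  Model VI-ter realises the other mode — a class in the kernel of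
`Ext¹(M, N) → Ext¹(M ⊗ 𝕃, N ⊗ 𝕃)` — and shows that it is invisible to `K₀`, to the
semisimplification (for Nori motives: to the weight-graded pieces, [HMS17, §10]), to the reduced
quotient of `P̃` (every field-valued point of the torsor) and to the period conjecture of the
localised category.  Consequently: granting Grothendieck's period conjecture for `MM_Nori`
(so that `P̃(MM_Nori) = P̃(MM^eff_Nori)[per⁻¹]` is a domain), `KZ.PiCancellation` says that
`P̃(MM^eff_Nori(ℚ̄))` is a DOMAIN; model VI violates this through a second component of its spectrum
(`P̃` reduced, not a domain — a failure seen by a point), model VI-ter through a NILPOTENT (`P̃` not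
reduced, spectrum irreducible with the localisation dense — a failure seen by no point).  A proof
must exclude both, and for the second — reducedness of `P̃(MM^eff_Nori(ℚ̄))` — no argument that sees
only semisimple objects, `K₀`, or points of the torsor can serve.
-/

noncomputable section

open scoped BigOperators nonZeroDivisors

namespace Summit.KontsevichZagierPeriods.KontsevichZagierPeriods.Theorems

namespace SoloInformedExtObj

open SoloInformedGrObj

variable {d : ℕ}

/-! ### 1. The kernel of semisimplification and of localisation on formal periods -/

/-- Every formal period of `𝒟_d` is `(a polynomial in per) + η(x) · η`. -/
theorem eq_liftGen_add_eta [NeZero d] (x : EFP d) : x = liftGen (ssMap x) + etaLin x • eta := by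
  conv_lhs => rw [← psiE_phiE x]
  rw [psiE_apply, phiE_fst, phiE_snd]

/-- `ker P̃(ss) = ℚ · η`. -/
theorem ssMap_eq_zero_iff [NeZero d] (x : EFP d) : ssMap x = 0 ↔ ∃ r : ℚ, x = r • eta := by
  constructor
  · intro h
    refine ⟨etaLin x, ?_⟩
    have hx := eq_liftGen_add_eta x
    rwa [h, map_zero, zero_add] at hx
  · rintro ⟨r, rfl⟩
    rw [map_smul, ssMap_eta, smul_zero]

/-- `Ann(per^{n+1}) = ℚ · η` for every `n`: the `per^∞`-torsion of `P̃(𝒟_d)` is exactly the line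
spanned by the extension period. -/
theorem per_pow_mul_eq_zero_iff [NeZero d] (n : ℕ) (x : EFP d) :
    per ^ (n + 1) * x = 0 ↔ ∃ r : ℚ, x = r • eta := by
  rw [← ssMap_eq_zero_iff]
  constructor
  · intro h
    have h1 : ssRingHom (per ^ (n + 1) : EFP d) * ssMap x = 0 := by
      rw [← ssRingHom_apply x, ← map_mul, h, map_zero]
    rw [map_pow, ssRingHom_apply, per, ssMap_genE, ← gen_nsmul, mul_comm] at h1
    exact mem_nonZeroDivisors_iff_right.1
      ((gen_mem_nonZeroDivisors_iff (G := ℕ) _).2 (IsAddRegular.all _)) _ h1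
  · intro h
    obtain ⟨r, rfl⟩ := (ssMap_eq_zero_iff x).1 h
    rw [pow_succ, mul_assoc, mul_smul_comm, per_mul_eta, smul_zero, mul_zero]

/-- `Ann(per) = ℚ · η`. -/
theorem per_mul_eq_zero_iff [NeZero d] (x : EFP d) : per * x = 0 ↔ ∃ r : ℚ, x = r • eta := by
  simpa using per_pow_mul_eq_zero_iff 0 x

/-- `P̃` of the localisation functor `F : 𝒟_d → 𝒟_d[𝕃⁻¹] = 𝒞_ℤ` (`X ↦ X^{ss}` read in the
group-graded model): `P̃(F) = P̃((ℕ ⊂ ℤ)_*) ∘ P̃(ss)`. -/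
def loc [NeZero d] : EFP d →+* FP ℤ := (fpMap (Nat.castAddMonoidHom ℤ)).comp ssRingHom

/-- `P̃(F)` on symbols: `⟦(X, σ, ω)⟧ ↦ ⟦(X^{ss}, σ, ω)⟧` (same basis and coordinates). -/
theorem loc_clsE [NeZero d] (X : SoloInformedExtObj d) (σ ω : X.gr.B → ℚ) :
    loc (clsE X σ ω) = cls (mapObj (Nat.castAddMonoidHom ℤ) X.gr) σ ω := by
  rw [loc, RingHom.comp_apply, ssRingHom_apply, ssMap_clsE, fpMap_cls]

/-- `P̃(F)(per) = p_1` is a unit of `P̃(𝒞_ℤ)` (`𝕃` becomes invertible). -/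
theorem isUnit_loc_per [NeZero d] : IsUnit (loc (per : EFP d)) := by
  rw [loc, RingHom.comp_apply, ssRingHom_apply, per, ssMap_genE, fpMap_gen]
  refine isUnit_iff_exists_inv.2 ⟨gen (-1 : ℤ), ?_⟩
  rw [← gen_add]
  have h : (Nat.castAddMonoidHom ℤ) 1 + -1 = 0 := by simp
  rw [h, gen_zero_eq_one]

/-- The semisimplification (the dense model `𝒞_ℕ`) satisfies EFF-INJ:
`P̃(𝒞_ℕ) → P̃(𝒞_ℤ)` is injective. -/
theorem loc_dense_injective : Function.Injective (fpMap (Nat.castAddMonoidHom ℤ)) :=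
  fpMap_injective _ fun a b h => Nat.cast_injective (R := ℤ) (by simpa using h)

/-- `ker P̃(F) = ℚ · η` (`= Ann(per)`). -/
theorem loc_eq_zero_iff [NeZero d] (x : EFP d) : loc x = 0 ↔ ∃ r : ℚ, x = r • eta := by
  rw [← ssMap_eq_zero_iff, loc, RingHom.comp_apply, ssRingHom_apply]
  constructor
  · intro h
    exact loc_dense_injective (by rw [h, map_zero])
  · intro h
    rw [h, map_zero]

/-- `P̃(F)(η) = 0`. -/
@[simp] theorem loc_eta [NeZero d] : loc (eta : EFP d) = 0 :=
  (loc_eq_zero_iff eta).2 ⟨1, (one_smul ℚ _).symm⟩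

/-- EFF-INJ FAILS for `𝒟_d`: `P̃(F)` is not injective. -/
theorem loc_not_injective [NeZero d] : ¬ Function.Injective (loc (d := d)) := fun h =>
  eta_ne_zero (h (by rw [loc_eta, map_zero]))

/-! ### 2. The period conjecture of `𝒟_d` fails at every comparison constant -/

/-- The evaluation (period) map of `𝒟_d` for the comparison `diag(c^{deg})` [HW22, Def. 7.11]:
`ev_c = ev_c^{𝒞_ℤ} ∘ P̃(F)`. -/
def evE [NeZero d] (c : ℂˣ) : EFP d →+* ℂ := (evRingHom (AddMonoidHom.id ℤ) c).comp loc

/-- `ev_c ⟦(X, σ, ω)⟧ = ω_ℂ(diag(c^{deg b}) σ_ℂ)` — HW22's evaluation for the fibre functor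
`X ↦ ℚ^{B_X}` (the extension matrix does not enter the fibre functor or the comparison). -/
theorem evE_clsE [NeZero d] (c : ℂˣ) (X : SoloInformedExtObj d) (σ ω : X.gr.B → ℚ) :
    evE c (clsE X σ ω) = ∑ b, (ω b : ℂ) * ((c : ℂ) ^ (X.gr.deg b : ℤ) * (σ b : ℂ)) := by
  rw [evE, RingHom.comp_apply, loc_clsE, ev_cls]
  rfl

/-- `ev_c(η) = 0`. -/
@[simp] theorem evE_eta [NeZero d] (c : ℂˣ) : evE c (eta : EFP d) = 0 := by
  rw [evE, RingHom.comp_apply, loc_eta, map_zero]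

/-- `ev_c(per) = c`. -/
@[simp] theorem evE_per [NeZero d] (c : ℂˣ) : evE c (per : EFP d) = c := by
  rw [evE, RingHom.comp_apply, loc, RingHom.comp_apply, ssRingHom_apply, per, ssMap_genE,
    fpMap_gen, ev_gen]
  simp

/-- THE FORMAL PERIOD CONJECTURE FAILS FOR `𝒟_d` AT EVERY comparison constant `c`
(transcendental or not): `η ≠ 0` is in the kernel. -/
theorem evE_not_injective [NeZero d] (c : ℂˣ) : ¬ Function.Injective (evE (d := d) c) :=
  fun h => eta_ne_zero (h (by rw [evE_eta, map_zero]))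

/-- … while for the localised category `𝒞_ℤ` it holds at `c = 2πi` (Lindemann). -/
theorem pc_fails_pc_localised_holds [NeZero d] :
    ¬ Function.Injective (evE (d := d) SoloInformedEffModel.twoPiI) ∧
      Function.Injective (evRingHom (G := ℤ) (AddMonoidHom.id ℤ) SoloInformedEffModel.twoPiI) :=
  ⟨evE_not_injective _, SoloInformedEffModel.pc_localised_twoPiI⟩

/-! ### 2bis. Contrast with model VI: there the phantom is seen by a `ℚ`-point -/

/-- The indicator of `𝟙 ∈ E` (`𝟙 ↦ 1`, `U ↦ 0`, `χⁿ ↦ 0`). -/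
def unitInd : SoloInformedEffIdx → ℚ
  | .zero => 1
  | .idem => 0
  | .chi _ => 0

/-- `unitInd` is a character of `(E, +)`: `a + b = 𝟙` only for `a = b = 𝟙`. -/
theorem unitInd_add (a b : SoloInformedEffIdx) : unitInd (a + b) = unitInd a * unitInd b := by
  change unitInd (SoloInformedEffIdx.add a b) = _
  rcases a with _ | _ | _ <;> rcases b with _ | _ | _ <;> simp [unitInd, SoloInformedEffIdx.add]

/-- The same character as a monoid homomorphism `Multiplicative E →* ℚ`. -/
def unitChar : Multiplicative SoloInformedEffIdx →* ℚ where
  toFun g := unitInd (Multiplicative.toAdd g)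
  map_one' := rfl
  map_mul' _ _ := unitInd_add _ _

/-- The `ℚ`-point `ψ` of `Spec P̃(𝒞_E)` "where `U` vanishes": `p_𝟙 ↦ 1`, `p_U ↦ 0`, `p_{χⁿ} ↦ 0`. -/
def psiPoint : FP SoloInformedEffIdx →+* ℚ :=
  (AddMonoidAlgebra.lift ℚ ℚ SoloInformedEffIdx unitChar).toRingHom.comp
    (fpRingEquiv (G := SoloInformedEffIdx)).toRingHom

/-- `ψ(p_g) = unitInd g`. -/
theorem psiPoint_gen (g : SoloInformedEffIdx) : psiPoint (gen g) = unitInd g := by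
  change AddMonoidAlgebra.lift ℚ ℚ _ unitChar (fpEquiv (gen g)) = _
  rw [fpEquiv_gen, AddMonoidAlgebra.lift_single, one_smul]
  rfl

/-- MODEL VI's PHANTOM IS SEEN BY A FIELD-VALUED POINT: `ψ(p_𝟙 − p_U) = 1` … -/
theorem psiPoint_phantom : psiPoint SoloInformedEffModel.phantom = 1 := by
  rw [SoloInformedEffModel.phantom, map_sub, psiPoint_gen, psiPoint_gen]
  change unitInd .zero - unitInd .idem = 1
  simp [unitInd]

/-- … whereas model VI-ter's phantom `η` is killed by EVERY homomorphism to a reduced ring, in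
particular by every `ℚ`-point and every evaluation: the extension failure mode is invisible to
points. -/
theorem phantom_visible_eta_invisible [NeZero d] :
    (∃ ψ : FP SoloInformedEffIdx →+* ℚ, ψ SoloInformedEffModel.phantom ≠ 0) ∧
      ∀ ψ : EFP d →+* ℚ, ψ eta = 0 :=
  ⟨⟨psiPoint, by rw [psiPoint_phantom]; exact one_ne_zero⟩, fun ψ => ringHom_eta ψ⟩

/-! ### 2ter. The two failure modes ring-theoretically: reduced-not-domain versus non-reduced -/

/-- `P̃(𝒞_ℤ)` is reduced: `ev_{2πi}` embeds it in `ℂ` (PC of the localised category). -/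
theorem fp_int_isReduced : IsReduced (FP ℤ) :=
  isReduced_of_injective _ SoloInformedEffModel.pc_localised_twoPiI

/-- `P̃(𝒞_ℕ)` is reduced (it embeds in `P̃(𝒞_ℤ)`). -/
theorem fp_nat_isReduced : IsReduced (FP ℕ) :=
  haveI := fp_int_isReduced
  isReduced_of_injective _ loc_dense_injective

/-- MODEL VI's effective period ring `P̃(𝒞_E)` is REDUCED: a nilpotent maps to `0` in the reduced ring
`P̃(𝒞_ℤ)`, hence is `r • (p_𝟙 − p_U)`, and `r = ψ(r • (p_𝟙 − p_U))` is nilpotent in `ℚ`.  (With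
`per · (p_𝟙 − p_U) = 0`: `P̃(𝒞_E)` is reduced and not a domain — `Spec P̃(𝒞_E) = 𝔸¹ ⊔ {ψ}` has a second
component.) -/
theorem fp_eff_isReduced : IsReduced (FP SoloInformedEffIdx) := by
  haveI := fp_int_isReduced
  refine ⟨fun x hx => ?_⟩
  obtain ⟨r, rfl⟩ :=
    (SoloInformedEffModel.ker_fpMap x).1 (hx.map (fpMap SoloInformedEffIdx.wt)).eq_zero
  have h : IsNilpotent (psiPoint (r • SoloInformedEffModel.phantom)) := hx.map psiPoint
  rw [map_rat_smul, psiPoint_phantom, smul_eq_mul, mul_one] at h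
  rw [h.eq_zero, zero_smul]

/-- … and `P̃(𝒞_E)` is not a domain. -/
theorem fp_eff_not_isDomain : ¬ IsDomain (FP SoloInformedEffIdx) := fun _ =>
  SoloInformedEffModel.phantom_ne_zero
    ((mul_eq_zero.1 SoloInformedEffModel.per_mul_phantom).resolve_left
      SoloInformedEffModel.per_ne_zero)

/-- MODEL VI-ter: the nilradical of `P̃(𝒟_d)` is exactly `ℚ · η = ker P̃(ss) = ker P̃(F)`; the reduced
quotient is `P̃(𝒞_ℕ) = ℚ[t] ↪ ℂ`.  (`Spec P̃(𝒟_d)` is irreducible with the localisation `𝔾_m` dense: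
"domain" fails by a NILPOTENT, not by a second component.) -/
theorem isNilpotent_iff [NeZero d] (x : EFP d) : IsNilpotent x ↔ ∃ r : ℚ, x = r • eta := by
  constructor
  · intro hx
    haveI := fp_nat_isReduced
    have h : ssMap x = 0 := by
      rw [← ssRingHom_apply]; exact (hx.map (ssRingHom (d := d))).eq_zero
    exact (ssMap_eq_zero_iff x).1 h
  · rintro ⟨r, rfl⟩
    exact ⟨2, by rw [pow_two, mul_smul_comm, mul_comm, mul_smul_comm, eta_mul_eta, smul_zero,
      smul_zero]⟩

/-- The nilradical is the kernel of `P̃(F)`: `x` nilpotent iff `P̃(F) x = 0` iff `per · x = 0`. -/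
theorem isNilpotent_iff_loc_eq_zero [NeZero d] (x : EFP d) :
    (IsNilpotent x ↔ loc x = 0) ∧ (IsNilpotent x ↔ per * x = 0) := by
  rw [isNilpotent_iff, loc_eq_zero_iff, per_mul_eq_zero_iff]; exact ⟨Iff.rfl, Iff.rfl⟩

/-- THE TWO FAILURE MODES.  Granting GPC, `P̃(MM) = P̃(MM^eff)[per⁻¹]` is a domain and the residual
conjunct EFF-INJ says `P̃(MM^eff)` is a domain.  Model VI breaks "domain" with `P̃(C^eff)` REDUCED (a
second component, seen by the point `ψ`); model VI-ter breaks it with `P̃(C^eff)` NON-REDUCED, its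
nilradical being the whole kernel of `P̃(F)` (seen by no point). -/
theorem failure_modes [NeZero d] :
    (IsReduced (FP SoloInformedEffIdx) ∧ ¬ IsDomain (FP SoloInformedEffIdx) ∧
        ¬ Function.Injective (fpMap (G := SoloInformedEffIdx) SoloInformedEffIdx.wt)) ∧
      (¬ IsReduced (EFP d) ∧ (∀ x : EFP d, IsNilpotent x ↔ loc x = 0) ∧
        ¬ Function.Injective (loc (d := d))) :=
  ⟨⟨fp_eff_isReduced, fp_eff_not_isDomain, SoloInformedEffModel.not_injective_fpMap⟩,
    ⟨not_isReduced, fun x => (isNilpotent_iff_loc_eq_zero x).1, loc_not_injective⟩⟩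

/-! ### 3. The mechanism: `− ⊗ 𝕃` is not full; `K ⊗ 𝕃 = K^{ss} ⊗ 𝕃`; `K ≇ K^{ss}` -/

/-- `− ⊗ 𝕃` on morphisms of `𝒟_d` (`N_{X ⊗ 𝕃} = 0`, so every graded matrix commutes). -/
def twistE {X Y : SoloInformedExtObj d} (g : EHom X Y) :
    EHom (tensorE X (lineE 1)) (tensorE Y (lineE 1)) where
  f := tensorLineHom 1 g.f
  comm p q := by
    simp [tensorE_lineE_nmat X one_ne_zero, tensorE_lineE_nmat Y one_ne_zero]

/-- `− ⊗ 𝕃` is faithful. -/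
theorem twistE_injective (X Y : SoloInformedExtObj d) :
    Function.Injective (twistE (X := X) (Y := Y)) := by
  rintro ⟨f, hf⟩ ⟨f', hf'⟩ h
  have h1 : f = f' := tensorLineHom_injective 1 X.gr Y.gr (congrArg EHom.f h)
  subst h1
  rfl

/-- `End K = ℚ`: an endomorphism of the Kummer object has equal diagonal entries
(commutation with `N` at `(e₀, e_d)`). -/
theorem kummer_end_diag (g : EHom (kummer d) (kummer d)) :
    g.f.mat false false = g.f.mat true true := by
  have h := g.comm false true
  simpa [Fintype.sum_bool] using h

/-- The idempotent `π = pr_{e_d ⊗ 𝕃}` of `K ⊗ 𝕃 = 𝟙_1 ⊕ 𝟙_{d+1}` — a morphism of `𝒟_d` since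
`N_{K ⊗ 𝕃} = 0`. -/
def kummerTwistProj : EHom (tensorE (kummer d) (lineE 1)) (tensorE (kummer d) (lineE 1)) where
  f :=
    { mat := fun p q => if p = q ∧ p.1 = true then 1 else 0
      graded := fun p q h => by
        by_cases hpq : p = q ∧ p.1 = true
        · exact absurd (by rw [hpq.1]) h
        · simp [hpq] }
  comm p q := by simp [tensorE_lineE_nmat (kummer d) one_ne_zero]

/-- `− ⊗ 𝕃` IS NOT FULL on `𝒟_d`: `π` is not of the form `g ⊗ 𝕃`
(`End K = ℚ · id` while `End(K ⊗ 𝕃) = ℚ × ℚ`). -/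
theorem twistE_not_full : ¬ Function.Surjective (twistE (X := kummer d) (Y := kummer d)) := by
  intro h
  obtain ⟨g, hg⟩ := h kummerTwistProj
  have h1 := congrArg (fun e : EHom _ _ => e.f.mat (true, ()) (true, ())) hg
  have h2 := congrArg (fun e : EHom _ _ => e.f.mat (false, ()) (false, ())) hg
  simp only [twistE, tensorLineHom_mat, kummerTwistProj, and_self, if_true] at h1 h2
  have h3 := kummer_end_diag g
  rw [h1, h2] at h3
  exact zero_ne_one h3

/-- The semisimplification `K^{ss} = 𝟙_0 ⊕ 𝟙_d` of the Kummer object, as a (split) object. -/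
@[reducible] def kummerSS : SoloInformedExtObj d := ofGr (kummer d).gr

/-- `K ⊗ 𝕃 = K^{ss} ⊗ 𝕃` — literally the same object of `𝒟_d` (twisting kills `N`). -/
theorem kummer_twist_eq : tensorE (kummer d) (lineE 1) = tensorE kummerSS (lineE 1) := by
  unfold tensorE
  rw [SoloInformedExtObj.mk.injEq]
  refine ⟨rfl, heq_of_eq ?_⟩
  funext p q
  simp [pr0, ofGr, lineE, line, kummer]

/-- Every morphism `K → K^{ss}` kills `e₀` … -/
theorem kummer_hom_ss_col (g : EHom (kummer d) kummerSS) (x : (kummer d).gr.B) :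
    g.f.mat x false = 0 := by
  have h := g.comm x true
  simpa [Fintype.sum_bool] using h

/-- … hence `K ≇ K^{ss}`: no morphism `K → K^{ss}` has a left inverse. -/
theorem kummer_not_split (g : EHom (kummer d) kummerSS) (g' : EHom kummerSS (kummer d)) :
    Hom.comp g'.f g.f ≠ Hom.id (kummer d).gr := by
  intro h
  have h1 := congrArg (fun f : Hom _ _ => f.mat false false) h
  simp [Hom.comp, Hom.id, kummer_hom_ss_col] at h1

/-! ### 4. Proposition VI-ter -/

/-- **Proposition VI-ter** (KERNEL).  In the abstract period formalism of [HW22, Ch. 7], for the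
extension model `𝒟_d` (`d ≠ 0`) and its localisation functor `F : 𝒟_d → 𝒞_ℤ`:
(1) EFF-INJ fails: `P̃(F)` is not injective; its kernel is `ℚ · η = Ann(per)`, `η² = 0 ≠ η`;
(2) the phantom is invisible: the semisimplification satisfies EFF-INJ, `P̃(ss)(η) = 0`, and every
ring homomorphism from `P̃(𝒟_d)` to a reduced ring kills `η`;
(3) the formal period conjecture fails for `𝒟_d` at every comparison constant, and holds for
`𝒞_ℤ` at `2πi`;
(4) mechanism: `− ⊗ 𝕃` is not full, `K ⊗ 𝕃 = K^{ss} ⊗ 𝕃`, `K ≇ K^{ss}`. -/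
theorem soloInformed_propositionVIter [NeZero d] :
    (¬ Function.Injective (loc (d := d)) ∧ (∀ x : EFP d, loc x = 0 ↔ ∃ r : ℚ, x = r • eta) ∧
      (∀ x : EFP d, per * x = 0 ↔ ∃ r : ℚ, x = r • eta) ∧
      (eta : EFP d) * eta = 0 ∧ (eta : EFP d) ≠ 0) ∧
    (Function.Injective (fpMap (Nat.castAddMonoidHom ℤ)) ∧ ssMap (eta : EFP d) = 0 ∧
      ∀ (L : Type) [CommRing L] [IsReduced L] (ψ : EFP d →+* L), ψ eta = 0) ∧
    ((∀ c : ℂˣ, ¬ Function.Injective (evE (d := d) c)) ∧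
      Function.Injective (evRingHom (G := ℤ) (AddMonoidHom.id ℤ) SoloInformedEffModel.twoPiI)) ∧
    (¬ Function.Surjective (twistE (X := kummer d) (Y := kummer d)) ∧
      tensorE (kummer d) (lineE 1) = tensorE kummerSS (lineE 1) ∧
      ∀ (g : EHom (kummer d) kummerSS) (g' : EHom kummerSS (kummer d)),
        Hom.comp g'.f g.f ≠ Hom.id (kummer d).gr) :=
  ⟨⟨loc_not_injective, loc_eq_zero_iff, per_mul_eq_zero_iff, eta_mul_eta, eta_ne_zero⟩,
    ⟨loc_dense_injective, ssMap_eta, fun _ _ _ ψ => ringHom_eta ψ⟩,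
    ⟨evE_not_injective, SoloInformedEffModel.pc_localised_twoPiI⟩,
    ⟨twistE_not_full, kummer_twist_eq, kummer_not_split⟩⟩

end SoloInformedExtObj

end Summit.KontsevichZagierPeriods.KontsevichZagierPeriods.Theorems
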